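import Summits.QuantumFields.YangMills.Theses.BackwardLiouvilleRigidity
import Literature.MathematicalPhysics.QuantumFieldTheory.Balaban1983to89.T4AveragingDisintegration
import HarnessLib

/-!
# Crux `OneStepBackwardContractionAdm` (stmt-QuantumFields-23156, route `BackwardLiouvilleRigidity`, rung R3), LINE 2 «organ-fibre-laplace»
# (planner ym-r3-idea-1 g12/g13): stub I `stub_fibreIdentityAE` — THE FIBRE IDENTITY, a.e. on the window

For consistent towers `μ_j = descend_* μ_{j+1}` with densities `ρ_k` (`μ_k = ρ_k dU_k`), positive on the windows, and a disintegration
`σ_j` of `dU_{j+1}` along `descend` (`(descend_* dU_{j+1}).bind σ_j = dU_{j+1}`, fibres carried a.e.):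
`log ∫ρ_{j+1} dσ_{j,V} − log ∫ρ′_{j+1} dσ_{j,V} = log ρ_j V − log ρ′_j V` for `dU_j`-a.e. window datum `V`.

PROOF ([folklore] measure theory).
* §1 `map_withDensity_eq_of_bind` — pushing a density through a disintegrated measure: if `(m.map d).bind σ = m` and the fibres are
  carried a.e., then `(f·m).map d = (∫⁻ f dσ_V)·(m.map d)` (`Measure.lintegral_bind` + the fibre clause).
* §2 `ae_eq_mul_rnDeriv_of_withDensity_eq` — if `F·μ = G·ν` (σ-finite), then `F = G · dν/dμ` `μ`-a.e. (Lebesgue decomposition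
  `ν = ν_s + (dν/dμ)·μ`; the singular part is invisible on a `μ`-full set; `ae_eq_of_forall_setLIntegral_eq_of_sigmaFinite`).
* §3 the stub: with `ν := descend_* dU_{j+1}`, `G(V) := ∫⁻ ρ_{j+1} dσ_V`, §1 and the tower give `ρ_j dU_j = μ_j = G·ν`, likewise
  `ρ′_j dU_j = G′·ν`; by §2 `ρ_j = G·h`, `ρ′_j = G′·h` a.e. with `h = dν/dU_j < ∞` a.e.; on the window `ρ_j, ρ′_j > 0` force
  `0 < h`, `0 < G, G′ < ∞`, so the normaliser `h` CANCELS: `log G − log G′ = log ρ_j − log ρ′_j`; finally `∫ ρ_{j+1} dσ_V = G(V).toReal`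
  (`ρ_{j+1} ≥ 0`, measurable: `MemAtHeight.nonneg/.measurable`).

Width seat ym-line-sfw-p2-w3 g28 (cell ym-idea-1; free hands, R3 family), `--supports stmt-QuantumFields-23156`.  THEOREMS ONLY.
HONEST FRAMING: the organ's content is stub S (`stub_fibreStepAdm`, XL, OPEN); no organ, crux, rung (R3 is a RECORD rung) or summit
is proved; the Yang–Mills mass gap is NOT proved by any of this.
-/

set_option autoImplicit false

noncomputable section

namespace Summit.QuantumFields.YangMills.Theorems.BackwardLiouvilleRigidity.FibreLaplace

open MeasureTheory ProbabilityTheory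
open scoped ENNReal
open Literature.MathematicalPhysics.QuantumFieldTheory.Balaban1983to89

/-! ## §1 Pushing a density through a disintegrated measure -/

/-- **Push-forward of a density through a disintegration.**  If `σ` disintegrates `m` along `d` (`(m.map d).bind σ = m`, fibres
carried a.e.), then for every measurable `f ≥ 0`: `(m.withDensity f).map d = (m.map d).withDensity (V ↦ ∫⁻ f dσ_V)`. [folklore] -/
theorem map_withDensity_eq_of_bind {X Y : Type*} [MeasurableSpace X] [MeasurableSpace Y] (m : Measure Y) {d : Y → X}
    (hd : Measurable d) (σ : Kernel X Y) (hbind : (m.map d).bind ⇑σ = m)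
    (hfib : ∀ᵐ V ∂(m.map d), ∀ᵐ U ∂(σ V), d U = V) {f : Y → ℝ≥0∞} (hf : Measurable f) :
    (m.withDensity f).map d = (m.map d).withDensity (fun V => ∫⁻ U, f U ∂(σ V)) := by
  ext A hA
  rw [Measure.map_apply hd hA, withDensity_apply _ (hd hA), withDensity_apply _ hA,
    ← lintegral_indicator (hd hA), ← lintegral_indicator hA]
  conv_lhs => rw [← hbind]
  rw [Measure.lintegral_bind σ.measurable.aemeasurable (hf.indicator (hd hA)).aemeasurable]
  refine lintegral_congr_ae ?_
  filter_upwards [hfib] with V hV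
  by_cases hVA : V ∈ A
  · rw [Set.indicator_of_mem hVA]
    refine lintegral_congr_ae ?_
    filter_upwards [hV] with U hU
    have hU' : U ∈ d ⁻¹' A := by rw [Set.mem_preimage, hU]; exact hVA
    rw [Set.indicator_of_mem hU']
  · rw [Set.indicator_of_notMem hVA]
    refine (lintegral_congr_ae ?_).trans lintegral_zero
    filter_upwards [hV] with U hU
    have hU' : U ∉ d ⁻¹' A := by rw [Set.mem_preimage, hU]; exact hVA
    rw [Set.indicator_of_notMem hU']

/-! ## §2 Comparing densities against a second reference measure -/

/-- **Densities through a Lebesgue decomposition.**  If `μ.withDensity F = ν.withDensity G` (both σ-finite, `F, G` measurable), then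
`F = G · (dν/dμ)` `μ`-almost everywhere — the singular part of `ν` is invisible on a `μ`-full set. [folklore] -/
theorem ae_eq_mul_rnDeriv_of_withDensity_eq {X : Type*} [MeasurableSpace X] (μ ν : Measure X) [SigmaFinite μ] [SigmaFinite ν]
    {F G : X → ℝ≥0∞} (hF : Measurable F) (hG : Measurable G) (h : μ.withDensity F = ν.withDensity G) :
    F =ᵐ[μ] G * ν.rnDeriv μ := by
  obtain ⟨S, hS, hsing, hμS⟩ := ν.mutuallySingular_singularPart μ
  have hdec := ν.haveLebesgueDecomposition_add μ
  have hr : Measurable (ν.rnDeriv μ) := Measure.measurable_rnDeriv ν μ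
  refine ae_eq_of_forall_setLIntegral_eq_of_sigmaFinite hF (hG.mul hr) fun A hA _ => ?_
  have hAS : ∀ g : X → ℝ≥0∞, ∫⁻ x in A, g x ∂μ = ∫⁻ x in A ∩ S, g x ∂μ := fun g =>
    setLIntegral_congr (MeasureTheory.inter_ae_eq_left_of_ae_eq_univ (MeasureTheory.ae_eq_univ.2 hμS)).symm
  have hAS' : MeasurableSet (A ∩ S) := hA.inter hS
  rw [hAS, hAS, ← withDensity_apply _ hAS', h, withDensity_apply _ hAS']
  conv_lhs => rw [hdec]
  rw [Measure.restrict_add, lintegral_add_measure,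
    Measure.restrict_eq_zero.2 (measure_mono_null Set.inter_subset_right hsing), lintegral_zero_measure, zero_add,
    setLIntegral_withDensity_eq_setLIntegral_mul μ hr hG hAS']
  refine setLIntegral_congr_fun hAS' (fun x _ => ?_)
  simp only [Pi.mul_apply, mul_comm]

/-! ## §3 The fibre identity -/

/-- **Stub I of «organ-fibre-laplace» (crux stmt-QuantumFields-23156) — the fibre identity, a.e. on the window.**
[cite: Balaban1987RG1, (0.13) p.254] -/
theorem stub_fibreIdentityAE :
    open scoped Classical in open MeasureTheory ProbabilityTheory Filter Topology Literature.MathematicalPhysics.QuantumFieldTheory.Balaban1983to89 T3ContinuumYM3Torus T3NestedUnitLaws T3UnitLawDensityEML BalabanUVClass T3UnitScaleTilt in ∀ (F : T3Family) (γ b₀ p₀ : ℝ) (j₀ : ℕ) (prm : ℕ → ClassParams) (η : ℕ → ℝ), ∀ (σ : (j : ℕ) → ProbabilityTheory.Kernel (GaugeField (F.P j) 0 ↥(Matrix.specialUnitaryGroup (Fin 2) ℂ)) (GaugeField (F.P (j + 1)) 0 ↥(Matrix.specialUnitaryGroup (Fin 2) ℂ))), (∀ j : ℕ, ProbabilityTheory.IsMarkovKernel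 (σ j) ∧ (Measure.map (descend F ℰp j) (fieldMeasure (F.P (j + 1)) 0 ↥(Matrix.specialUnitaryGroup (Fin 2) ℂ))).bind ⇑(σ j) = fieldMeasure (F.P (j + 1)) 0 ↥(Matrix.specialUnitaryGroup (Fin 2) ℂ) ∧ ∀ᵐ V ∂(Measure.map (descend F ℰp j) (fieldMeasure (F.P (j + 1)) 0 ↥(Matrix.specialUnitaryGroup (Fin 2) ℂ))), ∀ᵐ U ∂((σ j) V), descend F ℰp j U = V) → ∀ (μ μ' : ((j : ℕ) → MeasureTheory.Measure (GaugeField (F.P j) 0 ↥(Matrix.specialUnitaryGroup (Fin 2) ℂ)))) (ρ ρ' : ((j : ℕ) → GaugeField (F.P j) 0 ↥(Matrix.specialUnitaryGroup (Fin 2) ℂ) → ℝ)), (∀ j : ℕ, IsProbabilityMeasure (μ j) ∧ μ j = Measure.map (descend F ℰp j) (μ (j + 1))) → (∀ j : ℕ, IsProbabilityMeasure (μ' j) ∧ μ' j = Measure.map (descend F ℰp j) (μ' (j + 1))) → (∀ j : ℕ, j₀ ≤ j → ((∀ U, PlaqSmall (θBal F.L γ b₀ p₀ j) U → 0 < ρ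 j U ∧ 0 < ρ' j U) ∧ μ j = (fieldMeasure _ _ _).withDensity (fun U => ENNReal.ofReal (ρ j U)) ∧ μ' j = (fieldMeasure _ _ _).withDensity (fun U => ENNReal.ofReal (ρ' j U)) ∧ MemAtHeight F ℰp j (prm j) (ρ j) ∧ MemAtHeight F ℰp j (prm j) (ρ' j) ∧ μ j {U | ¬ PlaqSmall (θBal F.L γ b₀ p₀ j) U} ≤ ENNReal.ofReal (η j) ∧ μ' j {U | ¬ PlaqSmall (θBal F.L γ b₀ p₀ j) U} ≤ ENNReal.ofReal (η j) ∧ (ContinuousOn (ρ j) {U | PlaqSmall (θBal F.L γ b₀ p₀ j) U} ∧ ContinuousOn (ρ' j) {U | PlaqSmall (θBal F.L γ b₀ p₀ j) U}))) → ∀ j : ℕ, j₀ ≤ j → ∀ᵐ V ∂(fieldMeasure (F.P j) 0 ↥(Matrix.specialUnitaryGroup (Fin 2) ℂ)), PlaqSmall (θBal F.L γ b₀ p₀ j) V → Real.log (∫ X, ρ (j + 1) X ∂((σ j) V)) - Real.log (∫ X, ρ' (j + 1) X ∂((σ j) V)) = Real.log (ρ j V) - Real.log (ρ' j V) := by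
  intro F γ b₀ p₀ j₀ prm η σ hσ μ μ' ρ ρ' hμ hμ' hwin j hj
  obtain ⟨_, hbind, hfib⟩ := hσ j
  obtain ⟨hpos, hμj, hμ'j, -, -, -, -, -⟩ := hwin j hj
  obtain ⟨-, hμj1, hμ'j1, hmem1, hmem1', -, -, -⟩ := hwin (j + 1) (by omega)
  have hdesc : μ j = Measure.map (T3NestedUnitLaws.descend F T3UnitLawDensityEML.ℰp j) (μ (j + 1)) := (hμ j).2
  have hdesc' : μ' j = Measure.map (T3NestedUnitLaws.descend F T3UnitLawDensityEML.ℰp j) (μ' (j + 1)) := (hμ' j).2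
  have hd : Measurable (T3NestedUnitLaws.descend F T3UnitLawDensityEML.ℰp j :
      GaugeField (F.P (j + 1)) 0 ↥(Matrix.specialUnitaryGroup (Fin 2) ℂ) →
        GaugeField (F.P j) 0 ↥(Matrix.specialUnitaryGroup (Fin 2) ℂ)) :=
    T3NestedUnitLaws.measurable_descend F T3UnitLawDensityEML.ℰp T3UnitLawDensityEML.measurableE_ℰp j
  -- the densities at height `j + 1`: measurable and non-negative
  have hρ1m : Measurable (ρ (j + 1)) := hmem1.measurable
  have hρ1m' : Measurable (ρ' (j + 1)) := hmem1'.measurable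
  have hρ1n : ∀ U, 0 ≤ ρ (j + 1) U := fun U => hmem1.nonneg U
  have hρ1n' : ∀ U, 0 ≤ ρ' (j + 1) U := fun U => hmem1'.nonneg U
  -- the pushed-forward reference and the two fibre integrals
  set dU := fieldMeasure (F.P j) 0 ↥(Matrix.specialUnitaryGroup (Fin 2) ℂ) with hdU
  set dU1 := fieldMeasure (F.P (j + 1)) 0 ↥(Matrix.specialUnitaryGroup (Fin 2) ℂ) with hdU1
  set ν := Measure.map (T3NestedUnitLaws.descend F T3UnitLawDensityEML.ℰp j) dU1 with hν
  have hGm : Measurable fun V => ∫⁻ U, ENNReal.ofReal (ρ (j + 1) U) ∂((σ j) V) :=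
    (ENNReal.measurable_ofReal.comp hρ1m).lintegral_kernel
  have hGm' : Measurable fun V => ∫⁻ U, ENNReal.ofReal (ρ' (j + 1) U) ∂((σ j) V) :=
    (ENNReal.measurable_ofReal.comp hρ1m').lintegral_kernel
  -- the two identities of measures on `T_j`
  have hId : dU.withDensity (fun V => ENNReal.ofReal (ρ j V)) =
      ν.withDensity (fun V => ∫⁻ U, ENNReal.ofReal (ρ (j + 1) U) ∂((σ j) V)) := by
    rw [hdU, ← hμj, hdesc, hμj1]
    exact map_withDensity_eq_of_bind dU1 hd (σ j) hbind hfib (ENNReal.measurable_ofReal.comp hρ1m)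
  have hId' : dU.withDensity (fun V => ENNReal.ofReal (ρ' j V)) =
      ν.withDensity (fun V => ∫⁻ U, ENNReal.ofReal (ρ' (j + 1) U) ∂((σ j) V)) := by
    rw [hdU, ← hμ'j, hdesc', hμ'j1]
    exact map_withDensity_eq_of_bind dU1 hd (σ j) hbind hfib (ENNReal.measurable_ofReal.comp hρ1m')
  -- hence the densities against `dU_j`, almost everywhere
  have hρjm : Measurable fun V => ENNReal.ofReal (ρ j V) := by
    obtain ⟨-, -, -, hmem, -, -, -, -⟩ := hwin j hj
    exact ENNReal.measurable_ofReal.comp hmem.measurable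
  have hρjm' : Measurable fun V => ENNReal.ofReal (ρ' j V) := by
    obtain ⟨-, -, -, -, hmem', -, -, -⟩ := hwin j hj
    exact ENNReal.measurable_ofReal.comp hmem'.measurable
  have hae := ae_eq_mul_rnDeriv_of_withDensity_eq dU ν hρjm hGm hId
  have hae' := ae_eq_mul_rnDeriv_of_withDensity_eq dU ν hρjm' hGm' hId'
  have hlt := Measure.rnDeriv_lt_top ν dU
  filter_upwards [hae, hae', hlt] with V h1 h2 h3 hW
  obtain ⟨hρp, hρp'⟩ := hpos V hW
  simp only [Pi.mul_apply] at h1 h2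
  -- the normaliser `h = dν/dU` is positive and finite here; the fibre integrals are positive and finite
  have hr0 : ν.rnDeriv dU V ≠ 0 := fun h0 => by
    rw [h0, mul_zero] at h2
    exact (ENNReal.ofReal_pos.2 hρp').ne' h2
  have hrT : ν.rnDeriv dU V ≠ ⊤ := h3.ne
  have hG0 : (∫⁻ U, ENNReal.ofReal (ρ (j + 1) U) ∂((σ j) V)) ≠ 0 := fun h0 => by
    rw [h0, zero_mul] at h1
    exact (ENNReal.ofReal_pos.2 hρp).ne' h1
  have hGT : (∫⁻ U, ENNReal.ofReal (ρ (j + 1) U) ∂((σ j) V)) ≠ ⊤ := fun hT => by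
    rw [hT, ENNReal.top_mul hr0] at h1
    exact ENNReal.ofReal_ne_top h1
  have hG0' : (∫⁻ U, ENNReal.ofReal (ρ' (j + 1) U) ∂((σ j) V)) ≠ 0 := fun h0 => by
    rw [h0, zero_mul] at h2
    exact (ENNReal.ofReal_pos.2 hρp').ne' h2
  have hGT' : (∫⁻ U, ENNReal.ofReal (ρ' (j + 1) U) ∂((σ j) V)) ≠ ⊤ := fun hT => by
    rw [hT, ENNReal.top_mul hr0] at h2
    exact ENNReal.ofReal_ne_top h2
  -- real form of the density identities
  have e1 : ρ j V = (∫⁻ U, ENNReal.ofReal (ρ (j + 1) U) ∂((σ j) V)).toReal * (ν.rnDeriv dU V).toReal := by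
    have := congrArg ENNReal.toReal h1
    rwa [ENNReal.toReal_ofReal hρp.le, ENNReal.toReal_mul] at this
  have e2 : ρ' j V = (∫⁻ U, ENNReal.ofReal (ρ' (j + 1) U) ∂((σ j) V)).toReal * (ν.rnDeriv dU V).toReal := by
    have := congrArg ENNReal.toReal h2
    rwa [ENNReal.toReal_ofReal hρp'.le, ENNReal.toReal_mul] at this
  -- the fibre integrals as real integrals
  have i1 : ∫ X, ρ (j + 1) X ∂((σ j) V) = (∫⁻ U, ENNReal.ofReal (ρ (j + 1) U) ∂((σ j) V)).toReal :=
    integral_eq_lintegral_of_nonneg_ae (Filter.Eventually.of_forall hρ1n) hρ1m.aestronglyMeasurable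
  have i2 : ∫ X, ρ' (j + 1) X ∂((σ j) V) = (∫⁻ U, ENNReal.ofReal (ρ' (j + 1) U) ∂((σ j) V)).toReal :=
    integral_eq_lintegral_of_nonneg_ae (Filter.Eventually.of_forall hρ1n') hρ1m'.aestronglyMeasurable
  have hGr : (∫⁻ U, ENNReal.ofReal (ρ (j + 1) U) ∂((σ j) V)).toReal ≠ 0 := (ENNReal.toReal_pos hG0 hGT).ne'
  have hGr' : (∫⁻ U, ENNReal.ofReal (ρ' (j + 1) U) ∂((σ j) V)).toReal ≠ 0 := (ENNReal.toReal_pos hG0' hGT').ne'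
  have hrr : (ν.rnDeriv dU V).toReal ≠ 0 := (ENNReal.toReal_pos hr0 hrT).ne'
  rw [i1, i2, e1, e2, Real.log_mul hGr hrr, Real.log_mul hGr' hrr]
  ring

end Summit.QuantumFields.YangMills.Theorems.BackwardLiouvilleRigidity.FibreLaplace

end
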